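import Literature.NumberTheory.Weil1964.ArchVacuumSectionPlaces
import Literature.RepresentationTheory.KonnoKonno2007.JunctionVacuumSectionSwap
import HarnessLib

/-!
# Levi-family `KAK` inputs: the bundled interface, its operations, and the per-place instances

The Levi-family constructor `KonnoKonno2007.JunctionVacuumSectionLevi.kakImplementerData_leviFamily` turns ELEVEN
finite-dimensional inputs (a multiplicative phase action `γ` of a monoid `G` on `ℝ^σ × ℝ^σ`; compact generators `κ`
acting by `realify ∘ ιK`; an `A`-part `a` acting by the `U`-conjugate of the Levi phase map of dilations `L t` with
contragredients `Ld t`, operator-norm continuous; a proper surjective word map `K × P × K → G`) into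
`ArchVacuumSection.KAKImplementerData`, i.e. into the (w0)–(w2) auxiliary family of
`AdelicMetaplecticThetaMajorants.hasThetaMajorants_omega_comp` via `ArchSectionThetaMajorants`.  The same eleven inputs
are what is MULTIPLICATIVE: under products of groups (`JunctionVacuumSectionProd`), over a finite set of places
(`ArchVacuumSectionPlaces`), and under relabelling of the index (`JunctionVacuumSectionSwap` §1).  This file bundles them
as a structure `LeviKAKInput γ κ a` (data `ιK, U, L, Ld` + the eight identities / topological facts) and records

* `LeviKAKInput.kakImplementerData` — the output (`= kakImplementerData_leviFamily`);
* `LeviKAKInput.reindex ε` — transport along `ε : σ₀ ≃ σ` (phase action `reindexPhase ε ∘ γ`);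
* `LeviKAKInput.places` — the product over a finite type of places, slice by slice on `ℝ^{ι × o}` in the `placeBlock`
  convention of `ArchFollandCompact` §3 (phase action `placePhase`); with `reindex` this gives
  `kakImplementerData_leviFamily_places_reindex`, the form the archimedean pair group `Π_v (U(V_v) × U(W_v))` is fed in
  (per-place data on the dual-pair index `DPIdx P_v Q_v R_v S_v`, relabelled to the index `ι` of the global Hermitian
  matrix by the choice of a diagonalising basis at `v`);
* the per-place instances of the tree: `LeviKAKInput.ofCompact` (compact group, trivial `A`-part) and its dual-pair
  case `LeviKAKInput.junctionCompact` (both factors compact — the definite places),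
  `LeviKAKInput.junction` (real unitary dual pair `U(P,Q) × U(R,S)` with the FIRST factor of real rank one and the
  second compact — `JunctionVacuumSection` in Levi form, [KonnoKonno2007, §3.1]) and `LeviKAKInput.junctionSwap`
  (SECOND factor of real rank one, first compact — `JunctionVacuumSectionSwap`).

All statements are kernel-proved; no cited statement enters as a hypothesis.  The structure carries data and proofs
only (no `Prop`-valued definition is introduced).

References: G. B. Folland, Harmonic Analysis in Phase Space, Princeton UP 1989, §4.2 (4.24) p. 156, Prop. (4.39);
A. W. Knapp, Lie Groups Beyond an Introduction, 2nd ed., Birkhäuser 2002, Thm 7.39; C. Mœglin, M.-F. Vignéras,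
J.-L. Waldspurger, Correspondances de Howe sur un corps p-adique, LNM 1291 (1987), Ch. 1 I.17; K. Konno, T. Konno,
§3.1 (3.1).
-/

noncomputable section

open MeasureTheory Complex SchwartzMap Matrix
open scoped InnerProductSpace ComplexConjugate Real

namespace Literature.NumberTheory.Weil1964

open Literature.Analysis.SegalBargmann Literature.RepresentationTheory.HeisenbergGroup
open Literature.RepresentationTheory.KonnoKonno2007

local notation "SR" σ => SchwartzMap (σ → ℝ) ℂ
local notation "PV" σ => (σ → ℝ) × (σ → ℝ)

/-! ## 1. The bundled Levi-family input and its output -/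

section Structure

variable {σ : Type*} [Fintype σ] [DecidableEq σ] {G : Type*} [Monoid G] [TopologicalSpace G]
  {K : Type*} [TopologicalSpace K] {P : Type*} [TopologicalSpace P]

/-- **Levi-family `KAK` input** for a monoid `G` acting on the phase space `ℝ^σ × ℝ^σ` by `γ`, with compact
generators `κ : K → G` and `A`-part `a : P → G`: the eleven hypotheses of
`JunctionVacuumSectionLevi.kakImplementerData_leviFamily`, bundled.  Data: the unitary matrices `ιK k` realising
`γ (κ k)`, a unitary frame `U`, dilations `L t` and their contragredients `Ld t`.
[cite: Folland1989, §4.2 (4.24), Prop. (4.39); Knapp2002, Thm 7.39] -/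
structure LeviKAKInput (γ : G → PhaseMap σ) (κ : K → G) (a : P → G) where
  /-- `γ` is multiplicative. -/
  map_mul : ∀ g g' pq, γ (g * g') pq = γ g (γ g' pq)
  /-- the unitary matrices of the compact generators. -/
  ιK : K → Matrix.unitaryGroup σ ℂ
  /-- … depend continuously on the generator. -/
  continuous_ιK : Continuous ιK
  /-- the compact generators act by `realify ∘ ιK`. -/
  hreal : ∀ k pq, γ (κ k) pq = realify (ιK k) pq
  /-- the unitary frame of the `A`-part. -/
  U : Matrix.unitaryGroup σ ℂ
  /-- the dilations of the `A`-part in the frame `U`. -/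
  L : P → ((σ → ℝ) ≃ₗ[ℝ] (σ → ℝ))
  /-- their contragredients. -/
  Ld : P → ((σ → ℝ) ≃ₗ[ℝ] (σ → ℝ))
  /-- contragredience. -/
  had : ∀ t (x y : σ → ℝ), L t x ⬝ᵥ Ld t y = x ⬝ᵥ y
  /-- operator-norm continuity of `t ↦ (L t)⁻¹`. -/
  hL : Continuous fun t => (((L t).symm.toContinuousLinearEquiv : (σ → ℝ) ≃L[ℝ] (σ → ℝ)) :
    (σ → ℝ) →L[ℝ] (σ → ℝ))
  /-- the `A`-part acts by the `U`-conjugate of the Levi phase map. -/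
  hγA : ∀ t pq, γ (a t) pq = realify U⁻¹ (leviPhase (L t) (Ld t) (realify U pq))
  /-- the word map `(k, t, k') ↦ κ k · a t · κ k'` is proper … -/
  isProperMap_word : IsProperMap fun p : K × P × K => κ p.1 * a p.2.1 * κ p.2.2
  /-- … and onto (`G = K A K`). -/
  word_surjective : Function.Surjective fun p : K × P × K => κ p.1 * a p.2.1 * κ p.2.2

namespace LeviKAKInput

variable {γ : G → PhaseMap σ} {κ : K → G} {a : P → G}

/-- **The output**: vacuum-normalisable `KAK` implementer data with compact part `μ₀ ∘ ιK` and `A`-part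
`t ↦ μ₀(U)⁻¹ ∘ leviS (L t) ∘ μ₀(U)`. [cite: Folland1989, §4.2 (4.24), Prop. (4.39); Knapp2002, Thm 7.39] -/
theorem kakImplementerData (I : LeviKAKInput γ κ a) :
    KAKImplementerData γ κ a (fun k => unitaryOpPi (I.ιK k))
      (fun t => (unitaryOpPi I.U⁻¹).comp ((leviS (I.L t)).comp (unitaryOpPi I.U))) :=
  kakImplementerData_leviFamily I.map_mul I.ιK I.continuous_ιK I.hreal I.U I.had I.hL I.hγA I.isProperMap_word
    I.word_surjective

/-- **Trivial `A`-part** (`G = κ(K) · κ(K)` compact): frame `1`, dilations `1`. [cite: Folland1989, Prop. (4.39)] -/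
def ofCompact [CompactSpace K] [T2Space G] [ContinuousMul G] (hγ : ∀ g g' pq, γ (g * g') pq = γ g (γ g' pq))
    (hone : ∀ pq, γ 1 pq = pq) (hκ : Continuous κ) (ιK : K → Matrix.unitaryGroup σ ℂ) (hιK : Continuous ιK)
    (hreal : ∀ k pq, γ (κ k) pq = realify (ιK k) pq) (hKK : ∀ g : G, ∃ k₁ k₂ : K, κ k₁ * κ k₂ = g) :
    LeviKAKInput γ κ (fun _ : PUnit => (1 : G)) where
  map_mul := hγ
  ιK := ιK
  continuous_ιK := hιK
  hreal := hreal
  U := 1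
  L _ := LinearEquiv.refl ℝ (σ → ℝ)
  Ld _ := LinearEquiv.refl ℝ (σ → ℝ)
  had _ _ _ := rfl
  hL := continuous_const
  hγA _ pq := by
    rw [hone, leviPhase_apply, LinearEquiv.refl_apply, LinearEquiv.refl_apply, Prod.mk.eta, ← realify_mul,
      inv_mul_cancel, Literature.Analysis.SegalBargmann.realify_one]
  isProperMap_word := Continuous.isProperMap (by fun_prop)
  word_surjective g := by
    obtain ⟨k₁, k₂, h⟩ := hKK g
    exact ⟨(k₁, PUnit.unit, k₂), by simpa only [mul_one] using h⟩

end LeviKAKInput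

end Structure

/-! ## 2. Relabelling the index -/

section Reindex

variable {σ σ₀ : Type*} [Fintype σ] [DecidableEq σ] [Fintype σ₀] [DecidableEq σ₀] {G : Type*} [Monoid G]
  [TopologicalSpace G] {K : Type*} [TopologicalSpace K] {P : Type*} [TopologicalSpace P]

/-- `reindexUnitary ε : U(σ) → U(σ₀)` is continuous. [folklore] -/
theorem continuous_reindexUnitary (ε : σ₀ ≃ σ) :
    Continuous (reindexUnitary ε : Matrix.unitaryGroup σ ℂ → Matrix.unitaryGroup σ₀ ℂ) :=
  Continuous.subtype_mk (continuous_subtype_val.matrix_submatrix ε ε) _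

/-- **Transport of a Levi-family input along `ε : σ₀ ≃ σ`**: the phase action becomes `reindexPhase ε ∘ γ`, the
frame and the compact matrices are reindexed by `reindexUnitary ε`, the dilations by `reindexLin ε`; word map
unchanged. [folklore] -/
def LeviKAKInput.reindex {γ : G → PhaseMap σ} {κ : K → G} {a : P → G} (ε : σ₀ ≃ σ) (I : LeviKAKInput γ κ a) :
    LeviKAKInput (fun g => reindexPhase ε (γ g)) κ a where
  map_mul g g' pq := by
    have h : γ (g * g') = γ g ∘ γ g' := funext (I.map_mul g g')
    simp only [h, reindexPhase_comp, Function.comp_apply]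
  ιK k := reindexUnitary ε (I.ιK k)
  continuous_ιK := (continuous_reindexUnitary ε).comp I.continuous_ιK
  hreal k pq := by
    have h : γ (κ k) = realify (I.ιK k) := funext (I.hreal k)
    simp only [h, reindexPhase_realify]
  U := reindexUnitary ε I.U
  L t := reindexLin ε (I.L t)
  Ld t := reindexLin ε (I.Ld t)
  had t x y := reindexLin_dotProduct ε (I.had t) x y
  hL := continuous_reindexLin_symm ε I.hL
  hγA t pq := by
    have h : γ (a t) = fun w => realify I.U⁻¹ (leviPhase (I.L t) (I.Ld t) (realify I.U w)) := funext (I.hγA t)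
    simp only [h, reindexPhase_conj_leviPhase]
  isProperMap_word := I.isProperMap_word
  word_surjective := I.word_surjective

end Reindex

/-! ## 3. The product over places -/

section Places

variable {ι : Type} [Fintype ι] [DecidableEq ι] {o : Type} [Fintype o] [DecidableEq o]
  {G : o → Type*} [∀ v, Monoid (G v)] [∀ v, TopologicalSpace (G v)]
  {K P : o → Type*} [∀ v, TopologicalSpace (K v)] [∀ v, TopologicalSpace (P v)]

/-- **The product over places of Levi-family inputs** on the common index `ι`: slice-by-slice phase action
`placePhase`, frame `placeBlock (v ↦ U_v)`, compact matrices `placeBlock (v ↦ ιK_v (k v))`, dilations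
`placeLin (v ↦ L_v (t v))`, word map the product of the word maps. [cite: Folland1989, §4.2 (4.24), Prop. (4.39);
Knapp2002, Thm 7.39] -/
def LeviKAKInput.places {γ : ∀ v, G v → PhaseMap ι} {κ : ∀ v, K v → G v} {a : ∀ v, P v → G v}
    (I : ∀ v, LeviKAKInput (γ v) (κ v) (a v)) :
    LeviKAKInput (fun g : ∀ v, G v => placePhase fun v => γ v (g v)) (fun k : ∀ v, K v => fun v => κ v (k v))
      (fun t : ∀ v, P v => fun v => a v (t v)) where
  map_mul g g' pq := by
    have h : (fun v => γ v (g v * g' v)) = fun v => γ v (g v) ∘ γ v (g' v) :=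
      funext fun v => funext ((I v).map_mul (g v) (g' v))
    simp only [Pi.mul_apply, h, placePhase_comp, Function.comp_apply]
  ιK k := placeBlock fun v => (I v).ιK (k v)
  continuous_ιK := continuous_placeBlock.comp (continuous_pi fun v => (I v).continuous_ιK.comp (continuous_apply v))
  hreal k pq := by
    have h : (fun v => γ v (κ v (k v))) = fun v => realify ((I v).ιK (k v)) :=
      funext fun v => funext ((I v).hreal (k v))
    simp only [h, realify_placeBlock]
  U := placeBlock fun v => (I v).U
  L t := placeLin fun v => (I v).L (t v)
  Ld t := placeLin fun v => (I v).Ld (t v)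
  had t x y := placeLin_dotProduct (fun v => (I v).had (t v)) x y
  hL := continuous_placeLin_symm fun v => (I v).hL.comp (continuous_apply v)
  hγA t pq := by
    have h : (fun v => γ v (a v (t v))) =
        fun v => realify (I v).U⁻¹ ∘ leviPhase ((I v).L (t v)) ((I v).Ld (t v)) ∘ realify (I v).U :=
      funext fun v => funext ((I v).hγA (t v))
    simp only [h, placeBlock_inv, realify_placeBlock, leviPhase_placeLin, placePhase_comp, Function.comp_apply]
  isProperMap_word := isProperMap_word_places fun v => (I v).isProperMap_word
  word_surjective := surjective_word_places fun v => (I v).word_surjective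

/-- **`KAK` implementer data of `Π v, G v` on `𝓢(ℝ^{ι × o})` from Levi-family inputs at every place ON ITS OWN INDEX
TYPE `σ v`, relabelled to `ι` by `ε v : ι ≃ σ v`** (the composite `places ∘ reindex`, unbundled): phase action
`g ↦ placePhase (v ↦ (γ v (g v))^{ε v})`, frame `placeBlock (v ↦ (U v)^{ε v})`, dilations
`placeLin (v ↦ (L v (t v))^{ε v})`. [cite: Folland1989, §4.2 (4.24), Prop. (4.39); Knapp2002, Thm 7.39] -/
theorem kakImplementerData_leviFamily_places_reindex {σ : o → Type*} [∀ v, Fintype (σ v)]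
    [∀ v, DecidableEq (σ v)] (ε : ∀ v, ι ≃ σ v)
    {γ : ∀ v, G v → PhaseMap (σ v)} {κ : ∀ v, K v → G v} {a : ∀ v, P v → G v}
    (I : ∀ v, LeviKAKInput (γ v) (κ v) (a v)) :
    KAKImplementerData (fun g : ∀ v, G v => placePhase fun v => reindexPhase (ε v) (γ v (g v)))
      (fun k : ∀ v, K v => fun v => κ v (k v)) (fun t : ∀ v, P v => fun v => a v (t v))
      (fun k => unitaryOpPi (placeBlock fun v => reindexUnitary (ε v) ((I v).ιK (k v))))
      (fun t => (unitaryOpPi (placeBlock fun v => reindexUnitary (ε v) (I v).U)⁻¹).comp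
        ((leviS (placeLin fun v => reindexLin (ε v) ((I v).L (t v)))).comp
          (unitaryOpPi (placeBlock fun v => reindexUnitary (ε v) (I v).U)))) :=
  (LeviKAKInput.places fun v => (I v).reindex (ε v)).kakImplementerData

end Places

/-! ## 4. The per-place instances: real unitary dual pairs of real rank one in one factor -/

section RealDualPair

open Literature.NumberTheory.Automorphic Literature.NumberTheory.Automorphic.UnitaryGroup
open Literature.RepresentationTheory.KonnoKonno2007.RealDualPair

variable {P Q R S : Type*} [Fintype P] [DecidableEq P] [Fintype Q] [DecidableEq Q] [Fintype R]
  [DecidableEq R] [Fintype S] [DecidableEq S]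

-- Notation (NOT a definition), as in `JunctionVacuumSection`: the archimedean symplectic action of `G_∞` on the
-- polarised phase space, as phase maps — `γ𝕎 g = ⇑(ι𝕎 P Q R S g)`.
set_option quotPrecheck false in
local notation "γ𝕎[" P ", " Q ", " R ", " S "]" =>
  fun g : Ginf P Q R S => (⇑((ι𝕎 P Q R S g).1 : (PV (DPIdx P Q R S)) ≃ₗ[ℝ] PV (DPIdx P Q R S)) :
    PhaseMap (DPIdx P Q R S))

/-- **The pair `U(P,Q) × U(R,S)` with the FIRST factor of real rank one (`|Q| = 1`) and
`U(R) × U(S) → U(R,S)` onto**, in Levi form: frame `frameU R S p₀ q₀`, dilations `planeDil R S p₀ q₀ eᵗ` over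
`a_t = (hypV p₀ q₀ t, 1)` (`JunctionHyperbolicFamily.hypPhase_eq`, `JunctionVacuumSectionLevi.hypPhase_eq_conj_leviPhase`),
compact part `dualPairι`, word map `kakMapPair` (`JunctionVacuumSection.kakImplementerData_junction`).
[cite: KonnoKonno2007, §3.1 (3.1); Folland1989, §4.2 (4.24), Prop. (4.39); Knapp2002, Thm 7.39] -/
def LeviKAKInput.junction (p₀ : P) (q₀ : Q) [Subsingleton Q] (hW : Function.Surjective (UForm.kV R S)) :
    LeviKAKInput (γ𝕎[P, Q, R, S]) (κ P Q R S)
      (fun t : ℝ => (((hypV p₀ q₀ t : UForm P Q), (1 : UForm R S)) : Ginf P Q R S)) where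
  map_mul := symplecticPhaseMap_mul (ι𝕎 P Q R S)
  ιK := dualPairι
  continuous_ιK := continuous_dualPairι
  hreal k pq := ι𝕎_κ_apply R S k pq
  U := frameU R S p₀ q₀
  L t := planeDil R S p₀ q₀ (Real.exp t) (Real.exp_pos t).ne'
  Ld t := (planeDil R S p₀ q₀ (Real.exp t) (Real.exp_pos t).ne').symm
  had t x y := planeDil_dotProduct_symm R S p₀ q₀ (Real.exp t) (Real.exp_pos t).ne' x y
  hL := continuous_planeDil_exp_symm R S p₀ q₀
  hγA t pq := by
    rw [← hypPhase_eq_conj_leviPhase]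
    exact (hypPhase_eq R S p₀ q₀ t pq).symm
  isProperMap_word := (kakImplementerData_junction R S p₀ q₀ hW).isProperMap
  word_surjective := (kakImplementerData_junction R S p₀ q₀ hW).surjective

/-- **The pair `U(P,Q) × U(R,S)` with the SECOND factor of real rank one (`|S| = 1`) and
`U(P) × U(Q) → U(P,Q)` onto**, in Levi form: frame `frameW P Q r₀ s₀`, dilations `planeDilW P Q r₀ s₀ t` over
`a'_t = (1, hypV r₀ s₀ t)` (`JunctionVacuumSectionSwap`). [cite: MoeglinVignerasWaldspurger1987, Ch. 1 I.17;
KonnoKonno2007, §3.1 (3.1); Folland1989, §4.2 (4.24), Prop. (4.39); Knapp2002, Thm 7.39] -/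
def LeviKAKInput.junctionSwap (r₀ : R) (s₀ : S) [Subsingleton S] (hV : Function.Surjective (UForm.kV P Q)) :
    LeviKAKInput (γ𝕎[P, Q, R, S]) (κ P Q R S)
      (fun t : ℝ => (((1 : UForm P Q), (hypV r₀ s₀ t : UForm R S)) : Ginf P Q R S)) where
  map_mul := symplecticPhaseMap_mul (ι𝕎 P Q R S)
  ιK := dualPairι
  continuous_ιK := continuous_dualPairι
  hreal k pq := ι𝕎_κ_apply R S k pq
  U := frameW P Q r₀ s₀
  L t := planeDilW P Q r₀ s₀ t
  Ld t := (planeDilW P Q r₀ s₀ t).symm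
  had t x y := by
    rw [planeDilW, reindexLin_symm]
    exact reindexLin_dotProduct (swapIdx P Q R S)
      (planeDil_dotProduct_symm P Q r₀ s₀ (Real.exp t) (Real.exp_pos t).ne') x y
  hL := continuous_reindexLin_symm (swapIdx P Q R S) (continuous_planeDil_exp_symm P Q r₀ s₀)
  hγA := ι𝕎_one_hypV_eq_conj_leviPhase P Q r₀ s₀
  isProperMap_word := isProperMap_kakWordW P Q r₀ s₀
  word_surjective := kakWordW_surjective P Q r₀ s₀ hV

/-- consistency: the output of `LeviKAKInput.junction` is `JunctionVacuumSection.kakImplementerData_junction` (its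
`A`-part `hypOp R S p₀ q₀` is the Levi family by `rfl`, `JunctionVacuumSectionLevi.hypOp_eq_conj_leviS`). [folklore] -/
theorem LeviKAKInput.kakImplementerData_junction (p₀ : P) (q₀ : Q) [Subsingleton Q]
    (hW : Function.Surjective (UForm.kV R S)) :
    (LeviKAKInput.junction p₀ q₀ hW).kakImplementerData = kakImplementerData_junction R S p₀ q₀ hW := rfl

/-- consistency: the output of `LeviKAKInput.junctionSwap` is `kakImplementerData_junction_swap`. [folklore] -/
theorem LeviKAKInput.kakImplementerData_junctionSwap (r₀ : R) (s₀ : S) [Subsingleton S]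
    (hV : Function.Surjective (UForm.kV P Q)) :
    (LeviKAKInput.junctionSwap r₀ s₀ hV).kakImplementerData = kakImplementerData_junction_swap P Q r₀ s₀ hV := rfl

/-- `ι𝕎 1` is the identity of phase space. [folklore] -/
theorem ι𝕎_one_apply (pq : PV (DPIdx P Q R S)) :
    ((ι𝕎 P Q R S 1).1 : (PV (DPIdx P Q R S)) ≃ₗ[ℝ] PV (DPIdx P Q R S)) pq = pq := by
  rw [map_one]
  rfl

/-- **The pair `U(P,Q) × U(R,S)` with BOTH factors compact** (`U(P) × U(Q) → U(P,Q)` and `U(R) × U(S) → U(R,S)`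
onto — the definite places): trivial `A`-part, `G_∞ = κ(K)`. [cite: Folland1989, §4.2, the Schur remark p. 156,
Prop. (4.39); KonnoKonno2007, §3.1] -/
def LeviKAKInput.junctionCompact (hV : Function.Surjective (UForm.kV P Q))
    (hW : Function.Surjective (UForm.kV R S)) :
    LeviKAKInput (γ𝕎[P, Q, R, S]) (κ P Q R S) (fun _ : PUnit => (1 : Ginf P Q R S)) :=
  haveI := compactSpace_matrixUnitaryGroup P
  haveI := compactSpace_matrixUnitaryGroup Q
  haveI := compactSpace_matrixUnitaryGroup R
  haveI := compactSpace_matrixUnitaryGroup S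
  LeviKAKInput.ofCompact (symplecticPhaseMap_mul (ι𝕎 P Q R S)) ι𝕎_one_apply continuous_κ dualPairι
    continuous_dualPairι (fun k pq => ι𝕎_κ_apply R S k pq) fun g => by
      obtain ⟨k₁, hk₁⟩ := hV g.1
      obtain ⟨k₂, hk₂⟩ := hW g.2
      exact ⟨(k₁, k₂), 1, by rw [map_one, mul_one]; exact Prod.ext hk₁ hk₂⟩

/-- The case `Q`, `S` empty (both forms positive definite at the place). [cite: Folland1989, Prop. (4.39)] -/
def LeviKAKInput.junctionCompact_of_isEmpty [IsEmpty Q] [IsEmpty S] :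
    LeviKAKInput (γ𝕎[P, Q, R, S]) (κ P Q R S) (fun _ : PUnit => (1 : Ginf P Q R S)) :=
  LeviKAKInput.junctionCompact UForm.kV_surjective_of_isEmpty_right UForm.kV_surjective_of_isEmpty_right

end RealDualPair

end Literature.NumberTheory.Weil1964

end
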